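import Summits.MatrixMultiplication.MatrixMultiplication.Theses.TetrahedronCarving
import Summits.MatrixMultiplication.MatrixMultiplication.Theorems.EdgePencilExcess
import HarnessLib

/-!
# TetrahedronCarvingTetraFlatSplit — the decomposition record of the old attacked leaf, by name

(decomp-mm cell, landing bookkeeping for route `TetrahedronCarving` rev 4, the EXCESS RE-CUT of the
route-writer decision 2026-08-30; mathematics by lens 6, generation 20.)

Route item `TetraFlatSplit` (aside): `TetraFlat ↔ (HalfAlpha ∧ TetraExcessZero)`, i.e.
`ω(K₄) ≤ 4 ⟺ (1/2 ≤ α) ∧ (ω(K₄) ≤ ω(2,1,2))` — the old attacked leaf `TetraFlat` is exactly the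
conjunction of its rectangular half `HalfAlpha` (`α ≥ 1/2 ⟺ ω(2,1,2) = 4`) and its non-rectangular
half `TetraExcessZero` (the new attacked crux of the cut of record). Both directions are the landed
kernel theorem `Theorems.EdgePencil.tetraFlat_iff_halfAlpha_and_excessZero` (file
`Theorems/EdgePencilExcess.lean`), whose statement is this item with the two route definitions
`HalfAlpha`, `TetraExcessZero` unfolded; this file closes the item BY NAME. No new mathematics.

References: [cite: ChristandlVranaZuiddam2016, §1.3]; arXiv:1609.07476 §1.2–1.3; Le Gall 2012 §1 (`α`).
-/

set_option linter.dupNamespace false -- `MatrixMultiplication.MatrixMultiplication` (summit = problem, D-0017)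

noncomputable section

open Summit.MatrixMultiplication.MatrixMultiplication.Theses.TetrahedronCarving

namespace Summit.MatrixMultiplication.MatrixMultiplication.Theorems.TetrahedronCarvingTetraFlatSplit

/-- **Item `TetraFlatSplit`**: `TetraFlat ↔ (HalfAlpha ∧ TetraExcessZero)` — the tetrahedron sits at
exponent `4` iff `α ≥ 1/2` and the tetrahedron costs no more than the diamond, `ω(K₄) ≤ ω(2,1,2)`.
[cite: ChristandlVranaZuiddam2016, §1.3] -/
theorem tetraFlatSplit_holds : TetraFlatSplit :=
  Summit.MatrixMultiplication.MatrixMultiplication.Theorems.EdgePencil.tetraFlat_iff_halfAlpha_and_excessZero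

end Summit.MatrixMultiplication.MatrixMultiplication.Theorems.TetrahedronCarvingTetraFlatSplit

end
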